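import Summits.HodgeConjecture.HodgeConjecture.Theses.PadicSemiregularLift

/-!
# `PadicPridhamSemiregularity` (stmt-HodgeConjecture-13815) · Negative · the divided-power window collapses

Arithmetic heart of the TRANSVERSALITY step of every K₀-free restatement of the crux
(cards `absolute-atiyah-window-collapse`, `cartan-classifying-map`, `dgm-syntomic-receptacle`): in the
Taylor/HPD expansion of crystalline functoriality across the step `X_n ⊂ X_{n+1}` of the p-adic tower,
the term of order `j` in a difference `p^n θ` of local lifts carries `p^{nj}/j!`, and it dies modulo
`p^{n+1}` iff `v_p(p^{nj}/j!) ≥ n + 1`, i.e. `n + 1 + v_p(j!) ≤ nj`. Ideator 1 typed this as the stub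
`IdeatorOne.DividedPowerWindowCollapse` (Cruxes/…/IdeatorOneSketch.lean, one instance checked); the
standing disprover (refuter-cdisprove-stmt-HodgeConjecture-13815-g2-0, cycle 2, 2026-08-16) PROVES it
here for every odd prime `p`, `n ≥ 1`, `j ≥ 2` from Legendre's formula, and records that it FAILS at
`p = 2` — the one arithmetic corner where the mechanism predicts its own breakdown (outside the crux's
`p ≥ 7`). So no counterexample to P1b can come from a surviving higher divided-power term.
-/

namespace Summit.HodgeConjecture.HodgeConjecture.Theorems.PadicPridhamSemiregularity.Negative

/-- **The divided-power window collapses**: `n + 1 + v_p(j!) ≤ n·j` for every odd prime `p`, `n ≥ 1`,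
`j ≥ 2` (equivalently `γ_j(p^n x) = p^{nj}x^j/j! ∈ p^{n+1}W`). Proof: Legendre gives
`(p − 1)·v_p(j!) < j`, so `2·v_p(j!) < j`; then `n·j ≥ n(2v + 1) ≥ 2v + n ≥ n + 1 + v` when `v ≥ 1`, and
`n·j ≥ 2n ≥ n + 1` when `v = 0`. VERBATIM the statement of the stub `IdeatorOne.DividedPowerWindowCollapse`.
[folklore] -/
theorem dividedPowerWindowCollapse :
    ∀ (p : ℕ), p.Prime → p ≠ 2 → ∀ (n j : ℕ), 1 ≤ n → 2 ≤ j →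
      n + 1 + padicValNat p j.factorial ≤ n * j := by
  intro p hp hp2 n j hn hj
  haveI := Fact.mk hp
  have hlt : (p - 1) * padicValNat p j.factorial < j :=
    sub_one_mul_padicValNat_factorial_lt_of_ne_zero p (by omega)
  have h2v : 2 * padicValNat p j.factorial ≤ (p - 1) * padicValNat p j.factorial :=
    Nat.mul_le_mul_right _ (by have := hp.two_le; omega)
  have hA : n * (2 * padicValNat p j.factorial + 1) ≤ n * j := Nat.mul_le_mul_left n (by omega)
  have hB : padicValNat p j.factorial ≤ n * padicValNat p j.factorial :=
    Nat.le_mul_of_pos_left _ hn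
  have hC : n * (2 * padicValNat p j.factorial + 1) = 2 * (n * padicValNat p j.factorial) + n := by
    ring
  have hD : n * 2 ≤ n * j := Nat.mul_le_mul_left n hj
  rw [hC] at hA
  omega

/-- … and it **fails at `p = 2`** (`n = 1`, `j = 2`: `1 + 1 + v₂(2!) = 3 > 2`): the quadratic Taylor
term `4x²/2 = 2x²` survives modulo `4`. [folklore] -/
theorem dividedPowerWindow_fails_at_two :
    ¬ ((1 : ℕ) + 1 + padicValNat 2 (Nat.factorial 2) ≤ 1 * 2) := by
  have h2 : Nat.factorial 2 = 2 := by decide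
  rw [h2, padicValNat.self (by norm_num)]
  omega

/-- The collapse in the crux's range as a closed statement: for every prime `p ≥ 3` and all `n ≥ 1`,
`j ≥ 2`, `p^{n+1} ∣ p^{nj} / j!` in the precise valuation form `n + 1 ≤ nj − v_p(j!)`. [folklore] -/
theorem succ_le_mul_sub_padicValNat_factorial (p n j : ℕ) (hp : p.Prime) (hp3 : 3 ≤ p) (hn : 1 ≤ n)
    (hj : 2 ≤ j) : n + 1 ≤ n * j - padicValNat p j.factorial := by
  have h := dividedPowerWindowCollapse p hp (by omega) n j hn hj
  omega

end Summit.HodgeConjecture.HodgeConjecture.Theorems.PadicPridhamSemiregularity.Negative
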